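import Summits.ResolutionOfSingularities.ResolutionOfSingularities.Theses.UniversalCells
import Summits.ResolutionOfSingularities.ResolutionOfSingularities.Theorems.UniversalCellsProductDescentAffineInduction
import Literature.AlgebraicGeometry.Resolution.PrincipalizationToResolution
import Literature.AlgebraicGeometry.Resolution.CanonicalResolutionProofs
import Mathlib.AlgebraicGeometry.Fiber
import Mathlib.AlgebraicGeometry.Morphisms.Finite
import HarnessLib

/-!
# `ProductDescent` (crux stmt-ResolutionOfSingularities-15231, route `UniversalCells`) —
# the NORMAL FORM of the crux

Helper file (`--supports stmt-ResolutionOfSingularities-15231`; does not close the item).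

The crux `ProductDescent` (local resolvability descends from an open of `𝔸ˢ_Y` to `Y`) is
EQUIVALENT to its instance in which simultaneously

* `s = 1` (induction on `s`, landed: `VerticalLines.stub_affineInduction`);
* `Y` is AFFINE, the resolvable open is the whole of `W`, and `W` is AFFINE;
* the image point `y ∈ Y` is a CLOSED point of `Y` — so its residue field is a finite, hence
  perfect, field (Jacobson argument: `W` is Jacobson, a closed point `w₁` of `W` in
  `closure {w} ∩ W'` maps to a closed point `y₁` of `Y` with `y ⤳ y₁`, and an open
  neighbourhood of `y₁` contains `y`);
* `y` is a SINGULAR point of `Y` (at a regular point the open regular locus is its own resolution,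
  Matsumura 30.5 Cor., in tree);
* the point `w` upstairs is the GENERIC POINT OF ITS FIBRE: `j w` specialises to every point of
  `𝔸¹_Y` over `y` (the fibre of `𝔸¹_Y → Y` is irreducible — `GeometricallyIrreducible` in
  Mathlib — and its generic point lies in every open meeting the fibre).

So every future line for this crux may assume, by name (`ProductDescent_of_normalForm`), that it
is handed an affine resolvable open `W ↪ 𝔸¹_Y` through the generic point of the vertical line
over a closed singular point `y` (residue field `𝔽_q`): the regime singled out as the hard one by
the crux's `KERNEL.md` (descent of resolvability along `κ(y) → κ(y)(t)`) and by the disprover's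
gauntlet (`Cruxes/ProductDescent/Disproof.lean` §5b, witness W6: finite residue field).
The converse direction `ProductDescent → normal form` is the trivial specialisation, recorded as
`normalForm_of_productDescent`, and `productDescent_iff_normalForm` packages both.
-/

set_option linter.dupNamespace false -- mandated namespace of this single-conjunct summit

noncomputable section

open CategoryTheory AlgebraicGeometry Literature.AlgebraicGeometry.Resolution Topology
open Summit.ResolutionOfSingularities.ResolutionOfSingularities.Theses.UniversalCells (ProductDescent)

namespace Summit.ResolutionOfSingularities.ResolutionOfSingularities.Theorems.ProductDescent.NormalForm

/-- Regular points need no descent: the regular locus of a scheme locally of finite type over a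
field is open (Matsumura, Cor. to Thm. 30.5, in tree) and is its own resolution.
[cite: Matsumura1987, §30, Cor. to Thm. 30.5] -/
theorem exists_hasResolution_nhd_of_isRegularLocalRing {p : ℕ} [Fact p.Prime] {Y : Scheme.{0}}
    (f : Y ⟶ Spec (.of (ZMod p))) [LocallyOfFiniteType f] (y : Y)
    (hy : IsRegularLocalRing (Y.presheaf.stalk y)) :
    ∃ U : Y.Opens, y ∈ U ∧ Scheme.HasResolution (U : Scheme.{0}) := by
  let U : Y.Opens := ⟨Scheme.regularLocus Y, isOpen_regularLocus_of_locallyOfFiniteType_field f⟩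
  refine ⟨U, hy, Scheme.IsRegular.hasResolution ?_⟩
  intro x
  have hx : IsRegularLocalRing (Y.presheaf.stalk (U.ι.base x)) := x.2
  exact IsRegularLocalRing.of_ringEquiv (asIso (U.ι.stalkMap x)).commRingCatIsoToRingEquiv

/-- In a Jacobson space, every point of an open `V` specialises to a CLOSED point of the whole
space lying in `V` (closed points are dense in the locally closed set `closure {x} ∩ V`).
[folklore] -/
theorem exists_closedPoint_mem_of_mem {X : Scheme.{0}} [JacobsonSpace X] (V : X.Opens) {x : X}
    (hx : x ∈ V) : ∃ x' : X, x' ∈ V ∧ IsClosed ({x'} : Set X) ∧ x ⤳ x' := by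
  obtain ⟨x', ⟨hx'cl, hx'V⟩, hx'closed⟩ := nonempty_inter_closedPoints
    (Z := closure {x} ∩ (V : Set X)) ⟨x, subset_closure (Set.mem_singleton x), hx⟩
    (isClosed_closure.isLocallyClosed.inter V.isOpen.isLocallyClosed)
  exact ⟨x', hx'V, hx'closed, specializes_iff_mem_closure.mpr hx'cl⟩

/-- **The generic point of the vertical line through a point of an open `W ⊆ 𝔸¹_Y`.** For an open
immersion `j : W ⟶ 𝔸¹_Y` and `w ∈ W` there is `l ∈ W` with `l ⤳ w`, lying over the same point of
`Y`, such that `j l` specialises to EVERY point of `𝔸¹_Y` over that point: `j l` is the generic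
point of the fibre, which is irreducible (`𝔸¹_Y → Y` is geometrically irreducible, Mathlib) and
whose generic point lies in the open `j(W)` because it specialises to `j w`. [folklore] -/
theorem exists_fibreGenericPoint {Y W : Scheme.{0}} (j : W ⟶ 𝔸(Fin 1; Y)) [IsOpenImmersion j]
    (w : W) :
    ∃ l : W, l ⤳ w ∧ (𝔸(Fin 1; Y) ↘ Y).base (j.base l) = (𝔸(Fin 1; Y) ↘ Y).base (j.base w) ∧
      ∀ x : 𝔸(Fin 1; Y), (𝔸(Fin 1; Y) ↘ Y).base x = (𝔸(Fin 1; Y) ↘ Y).base (j.base l) →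
        j.base l ⤳ x := by
  set π : 𝔸(Fin 1; Y) ⟶ Y := 𝔸(Fin 1; Y) ↘ Y with hπ
  set y : Y := π.base (j.base w) with hy
  -- the generic point of the (irreducible) fibre of `π` over `y`, as a point of `𝔸¹_Y`
  set lam : 𝔸(Fin 1; Y) := (π.fiberι y).base (genericPoint (π.fiber y)) with hlam
  have hlam_y : π.base lam = y := by
    have : lam ∈ π.base ⁻¹' {y} := by
      rw [← Scheme.Hom.range_fiberι]
      exact ⟨_, rfl⟩
    simpa using this
  have hgen : ∀ x : 𝔸(Fin 1; Y), π.base x = y → lam ⤳ x := by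
    intro x hx
    have hx' : x ∈ Set.range (π.fiberι y).base := by
      rw [Scheme.Hom.range_fiberι]
      simpa using hx
    obtain ⟨x', rfl⟩ := hx'
    exact (genericPoint_specializes x').map (π.fiberι y).continuous
  -- `lam` lies in the open image of `j`, since it specialises to `j w`
  obtain ⟨l, hl⟩ : lam ∈ Set.range j.base :=
    (hgen (j.base w) rfl).mem_open j.isOpenEmbedding.isOpen_range ⟨w, rfl⟩
  refine ⟨l, ?_, ?_, ?_⟩
  · rw [← j.isOpenEmbedding.isInducing.specializes_iff, hl]
    exact hgen _ rfl
  · rw [hl, hlam_y]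
  · intro x hx
    rw [hl] at hx ⊢
    exact hgen x (hx.trans hlam_y)

/-- **NORMAL FORM OF THE CRUX.** `ProductDescent` follows from its instance with `s = 1`, `Y`
affine, `W` affine and resolvable as a whole, the image point `y` CLOSED (finite, perfect residue
field) and
SINGULAR, and `w` the generic point of the vertical line over `y` (i.e. `j w` specialises to every
point of `𝔸¹_Y` over `y`). Proof: `s = 1` suffices (`VerticalLines.stub_affineInduction`); a
regular `y` is settled by the open regular locus; otherwise pick a closed point `w₁` of the
Jacobson scheme `W` in `closure {w} ∩ W'` — its image `y₁` is closed (morphisms locally of finite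
type preserve closed points over a Jacobson base), still singular (the regular locus is open and
`y ⤳ y₁`), replace `w₁` by the generic point `l ∈ W'` of its vertical line, pass to an affine
open `B ∋ y₁` of `Y` (`𝔸¹_B ↪ 𝔸¹_Y` is the base change of `B ↪ Y`, `AffineSpace.isPullback_map`)
and to an affine open `V ∋ l` of `W' ∩ 𝔸¹_B` (resolutions restrict to opens), apply the normal
form at `(V ↪ 𝔸¹_B, l)`, transport the resolvable open of `B` it returns to `Y` along `B ↪ Y`,
and observe that it contains `y` because it contains `y₁` and `y ⤳ y₁`. [folklore] -/
theorem ProductDescent_of_normalForm :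
    (∀ p : ℕ, p.Prime → ∀ (Y : Scheme.{0}) (f : Y ⟶ Spec (.of (ZMod p))),
      IsSeparated f → LocallyOfFiniteType f → QuasiCompact f → IsIntegral Y → IsAffine Y →
      ∀ (W : Scheme.{0}) (j : W ⟶ 𝔸(Fin 1; Y)), IsOpenImmersion j → IsAffine W →
      Scheme.HasResolution W → ∀ w : W,
      IsClosed ({(𝔸(Fin 1; Y) ↘ Y).base (j.base w)} : Set Y) →
      ¬ IsRegularLocalRing (Y.presheaf.stalk ((𝔸(Fin 1; Y) ↘ Y).base (j.base w))) →
      (∀ x : 𝔸(Fin 1; Y), (𝔸(Fin 1; Y) ↘ Y).base x = (𝔸(Fin 1; Y) ↘ Y).base (j.base w) →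
        j.base w ⤳ x) →
      ∃ U : Y.Opens, (𝔸(Fin 1; Y) ↘ Y).base (j.base w) ∈ U ∧
        Scheme.HasResolution (U : Scheme.{0})) →
    ProductDescent := by
  intro h
  refine VerticalLines.stub_affineInduction ?_
  intro p hp Y f hs hl hq hi W j hj w hw
  obtain ⟨W', hw, hres⟩ := hw
  haveI : Fact p.Prime := ⟨hp⟩
  -- Step 0: a regular image point is settled by the regular locus
  by_cases hreg : IsRegularLocalRing (Y.presheaf.stalk ((𝔸(Fin 1; Y) ↘ Y).base (j.base w)))
  · exact exists_hasResolution_nhd_of_isRegularLocalRing f _ hreg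
  -- Step 1: a closed point `w₁ ∈ W'` with `w ⤳ w₁`; its image is closed, singular, and
  -- specialised to by the image of `w`
  haveI : JacobsonSpace Y := LocallyOfFiniteType.jacobsonSpace f
  let g : W ⟶ Y := j ≫ (𝔸(Fin 1; Y) ↘ Y)
  haveI : JacobsonSpace W := LocallyOfFiniteType.jacobsonSpace g
  have hg : ∀ x : W, g.base x = (𝔸(Fin 1; Y) ↘ Y).base (j.base x) := fun x => by
    simp [g]
  obtain ⟨w₁, hw₁W', hw₁closed, hww₁⟩ := exists_closedPoint_mem_of_mem W' hw
  have hy₁closed : IsClosed ({g.base w₁} : Set Y) :=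
    g.closePoints_subset_preimage_closedPoints hw₁closed
  have hyy₁ : g.base w ⤳ g.base w₁ := hww₁.map g.continuous
  have hy₁reg : ¬ IsRegularLocalRing (Y.presheaf.stalk (g.base w₁)) := by
    intro h₁
    apply hreg
    have hmem : g.base w ∈ Scheme.regularLocus Y :=
      hyy₁.mem_open (isOpen_regularLocus_of_locallyOfFiniteType_field f) h₁
    rw [hg] at hmem
    exact hmem
  -- Step 2: the generic point `l` of the vertical line through `w₁` (same image point); `l ∈ W'`
  obtain ⟨l, hlw₁, hl_eq, hlgen⟩ := exists_fibreGenericPoint j w₁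
  have hlW' : l ∈ W' := hlw₁.mem_open W'.isOpen hw₁W'
  have hl_eq' : (𝔸(Fin 1; Y) ↘ Y).base (j.base l) = g.base w₁ := by rw [hl_eq, hg]
  -- Step 3: an affine open `B ∋ y₁` of `Y`; `𝔸¹_B ↪ 𝔸¹_Y` is the base change of `B ↪ Y`
  obtain ⟨B, hB, hy₁B, -⟩ :=
    exists_isAffineOpen_mem_and_subset (X := Y) (x := g.base w₁) (U := ⊤) trivial
  have hsq := AffineSpace.isPullback_map (n := Fin 1) B.ι
  haveI : IsOpenImmersion (AffineSpace.map (Fin 1) B.ι) :=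
    MorphismProperty.of_isPullback (P := @IsOpenImmersion) hsq.flip inferInstance
  -- Step 4: an affine open neighbourhood `V` of `l` inside `W'` and over `B`; it is resolvable
  have hlB : g.base l ∈ B := by rw [hg, hl_eq']; exact hy₁B
  obtain ⟨V, hV, hlV, hVle⟩ := exists_isAffineOpen_mem_and_subset (X := W) (x := l)
    (U := W' ⊓ g ⁻¹ᵁ B) ⟨hlW', hlB⟩
  have hVW' : V ≤ W' := fun v hv => (hVle hv).1
  have hVB : ∀ v : V, g.base v.1 ∈ B := fun v => (hVle v.2).2
  have hresV : Scheme.HasResolution (V : Scheme.{0}) :=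
    Scheme.HasResolution.of_isOpenImmersion (W.homOfLE hVW') hres
  have hVj : ∀ v : V, (V.ι ≫ j).base v = j.base v.1 := fun v => by simp
  -- `V → B` and the induced open immersion `jB : V ↪ 𝔸¹_B`
  let toB : (V : Scheme.{0}) ⟶ B := IsOpenImmersion.lift B.ι (V.ι ≫ g) (by
    rintro _ ⟨v, rfl⟩
    rw [Scheme.Opens.range_ι]
    simpa using hVB v)
  have htoB : toB ≫ B.ι = V.ι ≫ g := IsOpenImmersion.lift_fac _ _ _
  have hcompat : (V.ι ≫ j) ≫ (𝔸(Fin 1; Y) ↘ Y) = toB ≫ B.ι := by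
    rw [htoB, Category.assoc]
  let jB : (V : Scheme.{0}) ⟶ 𝔸(Fin 1; B) := hsq.lift (V.ι ≫ j) toB hcompat
  have hjB₁ : jB ≫ AffineSpace.map (Fin 1) B.ι = V.ι ≫ j := hsq.lift_fst _ _ hcompat
  have hjB₂ : jB ≫ (𝔸(Fin 1; B) ↘ B) = toB := hsq.lift_snd _ _ hcompat
  haveI : IsOpenImmersion jB := by
    have : IsOpenImmersion (jB ≫ AffineSpace.map (Fin 1) B.ι) := by
      rw [hjB₁]; infer_instance
    exact IsOpenImmersion.of_comp jB (AffineSpace.map (Fin 1) B.ι)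
  -- the point `v₀ = l` of `V`, its image `yB` in `B`, and `B.ι yB = y₁`
  set v₀ : V := ⟨l, hlV⟩ with hv₀
  set yB : B := (𝔸(Fin 1; B) ↘ B).base (jB.base v₀) with hyB_def
  have hyB : B.ι.base yB = g.base w₁ := by
    have h1 : B.ι.base yB = (jB ≫ (𝔸(Fin 1; B) ↘ B) ≫ B.ι).base v₀ := by
      simp [hyB_def]
    rw [h1, ← Category.assoc, hjB₂, htoB, Scheme.Hom.comp_base, TopCat.comp_app, ← hl_eq', ← hg]
    rfl
  have hmap_v₀ : (AffineSpace.map (Fin 1) B.ι).base (jB.base v₀) = j.base l := by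
    rw [← TopCat.comp_app, ← Scheme.Hom.comp_base, hjB₁]
    simp [hv₀]
  -- instances on the affine base `B`
  haveI : IsAffine B := hB
  haveI : Nonempty B := ⟨⟨_, hy₁B⟩⟩
  haveI : QuasiCompact (B.ι ≫ f) := HasAffineProperty.iff_of_isAffine.mpr (inferInstance : CompactSpace B)
  -- Step 5: the normal form at the point `v₀` of `V ↪ 𝔸¹_B`
  obtain ⟨U, hU, hresU⟩ := h p hp B (B.ι ≫ f) inferInstance inferInstance inferInstance
    inferInstance hB V jB inferInstance hV hresV v₀
    (by
      -- `{yB} = B.ι ⁻¹ {y₁}` is closed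
      rw [← hyB_def]
      have hcl : IsClosed (B.ι.base ⁻¹' {g.base w₁}) := hy₁closed.preimage B.ι.continuous
      convert hcl using 1
      ext b
      simp only [Set.mem_singleton_iff, Set.mem_preimage]
      constructor
      · rintro rfl
        exact hyB
      · intro hb
        exact B.ι.isOpenEmbedding.injective (hb.trans hyB.symm))
    (by
      rw [← hyB_def]
      intro hregB
      apply hy₁reg
      rw [← hyB]
      exact IsRegularLocalRing.of_ringEquiv (asIso (B.ι.stalkMap yB)).commRingCatIsoToRingEquiv.symm)
    (by
      intro x hx
      rw [← hyB_def] at hx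
      -- compare over `Y`: both `map x` and `j l` lie over `y₁`
      have hx' : (𝔸(Fin 1; Y) ↘ Y).base ((AffineSpace.map (Fin 1) B.ι).base x) =
          (𝔸(Fin 1; Y) ↘ Y).base (j.base l) := by
        rw [← TopCat.comp_app, ← Scheme.Hom.comp_base, AffineSpace.map_over, Scheme.Hom.comp_base,
          TopCat.comp_app, hx, hyB, hl_eq']
      have hspec : j.base l ⤳ (AffineSpace.map (Fin 1) B.ι).base x := hlgen _ hx'
      rw [← hmap_v₀] at hspec
      exact ((AffineSpace.map (Fin 1) B.ι).isOpenEmbedding.isInducing.specializes_iff).mp hspec)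
  -- Step 6: transport the resolvable open `U ∋ yB` of `B` to `Y`; it contains `y₁`, hence `y`
  refine ⟨B.ι ''ᵁ U, ?_, Scheme.HasResolution.of_iso (B.ι.isoImage U).hom hresU⟩
  have hy₁U : g.base w₁ ∈ B.ι ''ᵁ U := ⟨yB, hU, hyB⟩
  have hwU : g.base w ∈ B.ι ''ᵁ U := hyy₁.mem_open (B.ι ''ᵁ U).isOpen hy₁U
  rwa [hg] at hwU

/-- The converse specialisation: `ProductDescent` implies its normal form (take `s = 1` and
`W' = ⊤`; the extra hypotheses are simply dropped). [folklore] -/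
theorem normalForm_of_productDescent (hPD : ProductDescent) :
    ∀ p : ℕ, p.Prime → ∀ (Y : Scheme.{0}) (f : Y ⟶ Spec (.of (ZMod p))),
      IsSeparated f → LocallyOfFiniteType f → QuasiCompact f → IsIntegral Y → IsAffine Y →
      ∀ (W : Scheme.{0}) (j : W ⟶ 𝔸(Fin 1; Y)), IsOpenImmersion j → IsAffine W →
      Scheme.HasResolution W → ∀ w : W,
      IsClosed ({(𝔸(Fin 1; Y) ↘ Y).base (j.base w)} : Set Y) →
      ¬ IsRegularLocalRing (Y.presheaf.stalk ((𝔸(Fin 1; Y) ↘ Y).base (j.base w))) →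
      (∀ x : 𝔸(Fin 1; Y), (𝔸(Fin 1; Y) ↘ Y).base x = (𝔸(Fin 1; Y) ↘ Y).base (j.base w) →
        j.base w ⤳ x) →
      ∃ U : Y.Opens, (𝔸(Fin 1; Y) ↘ Y).base (j.base w) ∈ U ∧
        Scheme.HasResolution (U : Scheme.{0}) :=
  fun p hp Y f hs hl hq hi _ W j hj _ hres w _ _ _ =>
    hPD p hp Y f hs hl hq hi 1 W j hj w ⟨⊤, trivial, hres.restrict ⊤⟩

/-- **`ProductDescent` ⟺ its normal form** (`s = 1`, `Y` and `W` affine, `W` resolvable, `y`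
closed and singular, `w` the generic point of the vertical line over `y`). [folklore] -/
theorem productDescent_iff_normalForm :
    ProductDescent ↔
    ∀ p : ℕ, p.Prime → ∀ (Y : Scheme.{0}) (f : Y ⟶ Spec (.of (ZMod p))),
      IsSeparated f → LocallyOfFiniteType f → QuasiCompact f → IsIntegral Y → IsAffine Y →
      ∀ (W : Scheme.{0}) (j : W ⟶ 𝔸(Fin 1; Y)), IsOpenImmersion j → IsAffine W →
      Scheme.HasResolution W → ∀ w : W,
      IsClosed ({(𝔸(Fin 1; Y) ↘ Y).base (j.base w)} : Set Y) →
      ¬ IsRegularLocalRing (Y.presheaf.stalk ((𝔸(Fin 1; Y) ↘ Y).base (j.base w))) →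
      (∀ x : 𝔸(Fin 1; Y), (𝔸(Fin 1; Y) ↘ Y).base x = (𝔸(Fin 1; Y) ↘ Y).base (j.base w) →
        j.base w ⤳ x) →
      ∃ U : Y.Opens, (𝔸(Fin 1; Y) ↘ Y).base (j.base w) ∈ U ∧
        Scheme.HasResolution (U : Scheme.{0}) :=
  ⟨normalForm_of_productDescent, ProductDescent_of_normalForm⟩

end Summit.ResolutionOfSingularities.ResolutionOfSingularities.Theorems.ProductDescent.NormalForm

end
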